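import Literature.AlgebraicGeometry.Frobenioids.ArithmeticFrobenioidThm64ivSolitary
import HarnessLib

/-!
# Frobenioids I, Theorem 6.4 (iv), second clause when the TARGET base field `F₂` is Galois over `ℚ`
# (GAP-LEDGER G-L1t3-1 #2, continued)

Mochizuki, *The geometry of Frobenioids I: the general theory*, Kyushu J. Math. **62** (2008) 293–400, §6,
Thm. 6.4 (iv) p. 115 l. 23–29 [cite: MochizukiFrdI2008, Thm. 6.4 (iv) p.115]; R. Perlis, *On the equation
`ζ_K(s) = ζ_{K'}(s)`*, J. Number Theory **9** (1977), Thm. 1 (d) and its corollaries («the two fields determine the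
same normal closure and the same normal core») [cite: Perlis1977, Thm. 1 (pp. 345–347)].

PROOF-ONLY file (cell abc-iut, layer L1; seat abc-iut-w4-d090 gen 5; 0 definitions). abc-iut-L1-d4 proved the
printed clause when the SOURCE base `F₁` is Galois over `ℚ` (Bauer); here the symmetric case — the TARGET base `F₂`
Galois over `ℚ` — from arithmetic equivalence (`ArithmeticFrobenioidThm64ivSolitary.lean`): a subgroup Gassmann
equivalent to a NORMAL subgroup equals it (`IsGassmannEquivalent.eq_of_normal`: every element of `H` is conjugate
to an element of `N`, hence lies in `N`, and the orders agree), so inside a common Galois number field the fixing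
subgroups of `F₁` and `F₂` coincide and `F₁ ≅ F₂` (`algEquiv_of_isGassmannEquivalent_of_isGalois_right/left`);
whence `Thm64iv_arith_compat_of_isGalois_target`. Nothing here bears on, or takes a side on, [IUTchIII] Cor. 3.12.
-/

noncomputable section

namespace Literature.AlgebraicGeometry.Frobenioids

open CategoryTheory Opposite NumberField
open Literature.NumberTheory.NumberFields

/-! ### A subgroup Gassmann equivalent to a normal subgroup is that subgroup -/

section Group

variable {G : Type*} [Group G] [Finite G]

/-- **Gassmann equivalence to a normal subgroup forces equality**: if `H` and `N ⊴ G` are Gassmann equivalent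
then `H = N` (each `x ∈ H` is `G`-conjugate to some element of `N`, hence in `N`; and `#H = #N`). This is the
group-theoretic content of Perlis' «same normal core / a Galois field is solitary». [cite: Perlis1977, Thm. 1 (p. 346, corollaries)] -/
theorem _root_.Literature.NumberTheory.NumberFields.IsGassmannEquivalent.eq_of_normal {H N : Subgroup G}
    (h : IsGassmannEquivalent H N) [hN : N.Normal] : H = N := by
  refine Subgroup.eq_of_le_of_card_ge (fun x hx => ?_) (le_of_eq h.card_eq.symm)
  have h1 : 0 < Nat.card {k : H // IsConj x (k : G)} :=
    Nat.card_pos_iff.mpr ⟨⟨⟨⟨x, hx⟩, IsConj.refl x⟩⟩, inferInstance⟩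
  rw [h x] at h1
  obtain ⟨⟨n, hn⟩⟩ := (Nat.card_pos_iff.mp h1).1
  obtain ⟨c, hc⟩ := isConj_iff.mp hn
  have hx' : x = c⁻¹ * (n : G) * c⁻¹⁻¹ := by rw [← hc]; group
  rw [hx']
  exact hN.conj_mem _ n.2 c⁻¹

end Group

/-! ### Number fields: Gassmann equivalent to a Galois field ⇒ isomorphic -/

section Fields

variable {N : Type} [Field N] [NumberField N] [IsGalois ℚ N]
  {K K' : Type} [Field K] [NumberField K] [Field K'] [NumberField K']

/-- If `K, K'` embed in a Galois number field `N` with Gassmann-equivalent fixing subgroups and `K'` is Galois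
over `ℚ`, then `K ≃ K'` over `ℚ` (the fixing subgroup of `K'` is normal, so the two fixing subgroups are equal and
the Galois correspondence identifies the images). [cite: Perlis1977, Thm. 1 (p. 346, corollaries)] -/
theorem algEquiv_of_isGassmannEquivalent_of_isGalois_right [IsGalois ℚ K'] (i : K →ₐ[ℚ] N) (i' : K' →ₐ[ℚ] N)
    (hG : IsGassmannEquivalent i.fieldRange.fixingSubgroup i'.fieldRange.fixingSubgroup) :
    Nonempty (K ≃ₐ[ℚ] K') := by
  -- `i' K'` is Galois over `ℚ` (transported along `K' ≃ i' K'`; the two `ℚ`-algebra structures on the subfield agree)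
  haveI : i'.fieldRange.fixingSubgroup.Normal :=
    @IsGalois.fixingSubgroup_normal_of_isGalois ℚ N _ _ _ i'.fieldRange _
      (isGalois_of_algebra_eq _ (Subsingleton.elim _ _) (IsGalois.of_algEquiv i'.equivFieldRange))
  have heq : i.fieldRange.fixingSubgroup = i'.fieldRange.fixingSubgroup := hG.eq_of_normal
  have hfix : i.fieldRange = i'.fieldRange := by
    rw [← IsGalois.fixedField_fixingSubgroup i.fieldRange, heq, IsGalois.fixedField_fixingSubgroup]
  exact ⟨(i.equivFieldRange.trans (IntermediateField.equivOfEq hfix)).trans i'.equivFieldRange.symm⟩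

/-- The same with `K` Galois over `ℚ`. [cite: Perlis1977, Thm. 1 (p. 346, corollaries)] -/
theorem algEquiv_of_isGassmannEquivalent_of_isGalois_left [IsGalois ℚ K] (i : K →ₐ[ℚ] N) (i' : K' →ₐ[ℚ] N)
    (hG : IsGassmannEquivalent i.fieldRange.fixingSubgroup i'.fieldRange.fixingSubgroup) :
    Nonempty (K ≃ₐ[ℚ] K') := by
  obtain ⟨e⟩ := algEquiv_of_isGassmannEquivalent_of_isGalois_right i' i hG.symm
  exact ⟨e.symm⟩

end Fields

/-! ### At the arithmetic Frobenioids -/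

section Arith

variable {F₁ : Type} [Field F₁] [NumberField F₁] {K₁ : Type} [Field K₁] [Algebra F₁ K₁] [IsGalois F₁ K₁]
variable {F₂ : Type} [Field F₂] [NumberField F₂] {K₂ : Type} [Field K₂] [Algebra F₂ K₂] [IsGalois F₂ K₂]

/-- **`F₁ ≅ F₂` when the TARGET base `F₂` is Galois over `ℚ`** (and some `X = Spec L₁` with `L₁` Galois over `ℚ`
exists, as in print): from the Cor. 4.11 (iv) datum of an equivalence of THE arithmetic Frobenioids, via arithmetic
equivalence ⇒ Gassmann equivalence in `Gal(L₁/ℚ)` ⇒ equality with the normal fixing subgroup of `F₂`.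
[cite: MochizukiFrdI2008, Thm. 6.4 (iv) p.115] -/
theorem nonempty_baseRingEquiv_arith_of_isGalois_target [IsGalois ℚ F₂]
    (Ψ : arithFrobenioid F₁ K₁ ≌ arithFrobenioid F₂ K₂)
    {ΨBase : FinSubextCat F₁ K₁ ⥤ FinSubextCat F₂ K₂} [ΨBase.IsEquivalence]
    (E : PreFrobenioidData.DivisorMonoidIsoOverBase (arithFrobenioidOps F₁ K₁) (arithFrobenioidOps F₂ K₂) ΨBase)
    (η : Ψ.functor ⋙ (arithFrobenioidOps F₂ K₂).base ≅ (arithFrobenioidOps F₁ K₁).base ⋙ ΨBase)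
    (hdiv : ∀ ⦃A B : arithFrobenioid F₁ K₁⦄ (φ : A ⟶ B),
      (arithFrobenioidOps F₂ K₂).div (Ψ.functor.map φ) =
        (arithFrobenioidOps F₂ K₂).pull (η.hom.app A)
          (E.iso ((arithFrobenioidOps F₁ K₁).base.obj A) ((arithFrobenioidOps F₁ K₁).div φ)))
    (B₁ : FinSubextCat F₁ K₁) (ε₁ : B₁.L ≃ₐ[F₁] F₁) (X : FinSubextCat F₁ K₁) (hX : IsGalois ℚ X.L) :
    Nonempty (F₁ ≃+* F₂) := by
  haveI := hX
  obtain ⟨e⟩ := Thm64iv_arith_fieldIso Ψ E η hdiv X hX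
  let i : F₁ →ₐ[ℚ] X.L := (algebraMap F₁ X.L).toRatAlgHom
  let i' : F₂ →ₐ[ℚ] X.L := (e.symm.toRingHom.comp (algebraMap F₂ (ΨBase.obj X).L)).toRatAlgHom
  obtain ⟨φ⟩ := algEquiv_of_isGassmannEquivalent_of_isGalois_right i i'
    (arith_base_isGassmannEquivalent Ψ E η hdiv B₁ ε₁ X.L i i')
  exact ⟨φ.toRingEquiv⟩

/-- **[FrdI] Thm. 6.4 (iv), second clause IN FULL at the constructions when `F₂` is Galois over `ℚ`**: at every
`X' = Spec L₁'` with `L₁'` Galois over `ℚ`, `(Ψ^Base X').L ≅ L₁'` compatibly with an isomorphism `F₁ ≅ F₂`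
(given one `X` Galois over `ℚ`, e.g. `X' = X`). [cite: MochizukiFrdI2008, Thm. 6.4 (iv) p.115] -/
theorem Thm64iv_arith_compat_of_isGalois_target [IsGalois ℚ F₂]
    (Ψ : arithFrobenioid F₁ K₁ ≌ arithFrobenioid F₂ K₂)
    {ΨBase : FinSubextCat F₁ K₁ ⥤ FinSubextCat F₂ K₂} [ΨBase.IsEquivalence]
    (E : PreFrobenioidData.DivisorMonoidIsoOverBase (arithFrobenioidOps F₁ K₁) (arithFrobenioidOps F₂ K₂) ΨBase)
    (η : Ψ.functor ⋙ (arithFrobenioidOps F₂ K₂).base ≅ (arithFrobenioidOps F₁ K₁).base ⋙ ΨBase)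
    (hdiv : ∀ ⦃A B : arithFrobenioid F₁ K₁⦄ (φ : A ⟶ B),
      (arithFrobenioidOps F₂ K₂).div (Ψ.functor.map φ) =
        (arithFrobenioidOps F₂ K₂).pull (η.hom.app A)
          (E.iso ((arithFrobenioidOps F₁ K₁).base.obj A) ((arithFrobenioidOps F₁ K₁).div φ)))
    (B₁ : FinSubextCat F₁ K₁) (ε₁ : B₁.L ≃ₐ[F₁] F₁) (X : FinSubextCat F₁ K₁) (hX : IsGalois ℚ X.L)
    (X' : FinSubextCat F₁ K₁) (hX' : IsGalois ℚ X'.L) :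
    ∃ (e : X'.L ≃+* (ΨBase.obj X').L) (e₀ : F₁ ≃+* F₂),
      ∀ a : F₁, e (algebraMap F₁ X'.L a) = algebraMap F₂ (ΨBase.obj X').L (e₀ a) := by
  obtain ⟨φ⟩ := nonempty_baseRingEquiv_arith_of_isGalois_target Ψ E η hdiv B₁ ε₁ X hX
  exact Thm64iv_arith_compat_of_baseIso Ψ E η hdiv φ X' hX'

end Arith

end Literature.AlgebraicGeometry.Frobenioids

end
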